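import Literature.AlgebraicGeometry.Resolution.DiffOpPrincipalParts
import Literature.AlgebraicGeometry.Resolution.DiffOpLinearOverUnramified
import Literature.AlgebraicGeometry.Resolution.DiffOpSmoothExtension
import Mathlib.RingTheory.Etale.Basic
import Mathlib.RingTheory.Ideal.Cotangent
import HarnessLib

/-!
# Differential operators are determined on a formally unramified subalgebra; étale = unique extension

Topic `Literature/AlgebraicGeometry/Resolution`; companion of `DiffOpSmoothExtension.lean` (EXISTENCE of extensions of
differential operators along formally SMOOTH algebras) and `DiffOpPrincipalParts.lean` (EGA IV₄ Prop. 16.8.8: `D` has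
order `≤ n` iff `a ⊗ t ↦ a · D t` kills `ℑ^{n+1}`, `ℑ = ker (A ⊗_R A → A)`).

**Theorem** (`IsDiffOpLE.eq_zero_of_apply_algebraMap`, `IsDiffOpLE.eq_of_apply_algebraMap_eq`). Let `R → A → B` be
commutative rings with `B` FORMALLY UNRAMIFIED over `A` (`Ω_{B/A} = 0`: étale algebras, localisations, quotients,
separable algebraic field extensions …). Then an `R`-linear differential operator `D : B → B` of finite order is determined by
its restriction to the image of `A`: if `D₁`, `D₂` have order `≤ n` and agree on `φ(A)` then `D₁ = D₂`. With
`DiffOpSmoothExtension.lean`: along a formally ÉTALE algebra every differential operator `T : A → B` of order `≤ n` over the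
structure map extends UNIQUELY to an operator of order `≤ n` on `B` (`IsDiffOpOver.existsUnique_extend`,
`IsDiffOpLE.existsUnique_extend_of_formallyEtale`).

Proof. Induction on the order. If `E` has order `≤ n + 1` and vanishes on `φ(A)`, every commutator `[E, φ a]` has order
`≤ n` and vanishes on `φ(A)`, hence is `0` by induction: `E` is `A`-LINEAR, so it is a differential operator of `B` relative
to `A` (scalar-agnostic criterion `IsDiffOpLE.of_coe_eq`, `DiffOpLinearOverUnramified.lean`). By EGA IV₄ 16.8.8 its
extension `b ⊗ t ↦ b · E t` kills `ℑ_{B/A}^{n+2}`; but `Ω_{B/A} = ℑ/ℑ² = 0` makes `ℑ` idempotent (Mathlib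
`Ideal.cotangent_subsingleton_iff`), so `ℑ^{n+2} = ℑ` and `E` has order `≤ 0`, i.e. `E(b) = b · E(1) = 0`
(`isDiffOpLE_zero_of_formallyUnramified`). The order-`0` case is the same computation.

Motivation (cell `res-hironaka`, lane HIRONAKA-L; nothing about any manuscript is asserted here): uniqueness of the
differential operators on étale charts / local rings of smooth schemes extending the Hasse–Schmidt operators of affine space
(Hironaka 2017 §3.1 Def. 3.3, §7.4 p.38 l.16–18 «extension of the differential operators of `O_ξ`», typed
`Hironaka2017.S07Permissible.U38L16_1`), and `Diff` along étale morphisms in general.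

Sources: [EGAIV4] Prop. (16.8.8) p.42–43 (the `ℑ^{n+1}` criterion), Prop. (17.2.1) (formally unramified ⇔ `Ω¹ = 0`),
Déf. (17.1.1); [Matsumura1987] §25 (Thm. 25.3: unramified field extensions). -- TODO(general form): `Diff^n_{B/R} =
B ⊗_A Diff^n_{A/R}` for `B` étale over `A` with `A` smooth over `R` (needs the generation half, EGA IV₄ 16.11.2).
-/

namespace Literature.AlgebraicGeometry.Resolution

open scoped TensorProduct

universe u v w

section Unramified

variable (R : Type u) {A : Type v} {B : Type w} [CommRing R] [CommRing A] [CommRing B] [Algebra R B] [Algebra A B]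

/-- **`Ω_{B/A} = 0` makes the diagonal ideal idempotent**: for `B` formally unramified over `A`,
`ℑ_{B/A}^{n+1} = ℑ_{B/A}` for every `n` (`Ω_{B/A} = ℑ/ℑ²`). [cite: EGAIV4, Prop. (17.2.1) (formally unramified ⇔ Ω¹ = 0) with (16.3.1) (Ω¹ = ℑ/ℑ²)] -/
theorem kaehlerIdeal_pow_succ_eq_of_formallyUnramified [Algebra.FormallyUnramified A B] (n : ℕ) :
    KaehlerDifferential.ideal A B ^ (n + 1) = KaehlerDifferential.ideal A B := by
  have hΩ : Subsingleton (KaehlerDifferential.ideal A B).Cotangent := inferInstanceAs (Subsingleton Ω[B⁄A])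
  exact ((Ideal.cotangent_subsingleton_iff _).mp hΩ).pow_succ_eq n

omit [Algebra R B] in
/-- **Over a formally unramified base every differential operator of finite order has order `≤ 0`**: an `A`-LINEAR
differential operator `E` of the `A`-algebra `B` (relative to `A`) of order `≤ n` is `B`-linear when `B` is formally
unramified over `A` — by EGA IV₄ 16.8.8 it kills `ℑ_{B/A}^{n+1} = ℑ_{B/A}`. [cite: EGAIV4, Prop. (16.8.8) p.42–43 and Prop. (17.2.1)] -/
theorem IsDiffOpLE.isDiffOpLE_zero_of_formallyUnramified [Algebra.FormallyUnramified A B] {n : ℕ} {E : B →ₗ[A] B}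
    (hE : IsDiffOpLE A n E) : IsDiffOpLE A 0 E := by
  rw [EGA4_16_8.isDiffOpLE_iff_kills] at hE ⊢
  rw [kaehlerIdeal_pow_succ_eq_of_formallyUnramified] at hE ⊢
  exact hE

omit [Algebra A B] in
/-- An operator of order `≤ 0` (i.e. `B`-linear) with `E(1) = 0` vanishes. [cite: EGAIV4, Prop. (16.8.8) (b) p.42 (order ≤ 0 = linear)] -/
theorem IsDiffOpLE.eq_zero_of_zero_of_map_one {S : Type*} [CommRing S] [Algebra S B] {E : B →ₗ[S] B}
    (hE : IsDiffOpLE S 0 E) (h1 : E 1 = 0) : E = 0 := by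
  ext b
  have h := LinearMap.congr_fun (hE b) 1
  rw [commMul_apply, LinearMap.zero_apply, mul_one, h1, mul_zero, sub_zero] at h
  rw [h, LinearMap.zero_apply]

/-- **A differential operator of finite order vanishing on a formally unramified subalgebra vanishes**: for `B` formally
unramified over `A` and `E : B → B` `R`-linear of order `≤ n` with `E(φ a) = 0` for all `a ∈ A`, `E = 0`. (Induction on
`n`: the commutators `[E, φ a]` vanish on `φ(A)` and have order `≤ n − 1`, hence vanish, so `E` is `A`-linear; then
`isDiffOpLE_zero_of_formallyUnramified`.) [cite: EGAIV4, Prop. (16.8.8) p.42–43, Prop. (17.2.1); Matsumura1987, Thm. 25.3] -/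
theorem IsDiffOpLE.eq_zero_of_apply_algebraMap [Algebra.FormallyUnramified A B] :
    ∀ {n : ℕ} {E : B →ₗ[R] B}, IsDiffOpLE R n E → (∀ a : A, E (algebraMap A B a) = 0) → E = 0
  | 0, E, hE, h0 => hE.eq_zero_of_zero_of_map_one (by rw [← map_one (algebraMap A B)]; exact h0 1)
  | n + 1, E, hE, h0 => by
    -- the commutators with `φ(A)` vanish
    have hcomm : ∀ a : A, commMul R E (algebraMap A B a) = 0 := fun a =>
      IsDiffOpLE.eq_zero_of_apply_algebraMap (hE (algebraMap A B a)) fun a' => by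
        rw [commMul_apply, ← map_mul, h0, h0, mul_zero, sub_zero]
    -- so `E` is `A`-linear
    let E' : B →ₗ[A] B :=
      { toFun := E
        map_add' := E.map_add
        map_smul' := fun a y => by
          have h := LinearMap.congr_fun (hcomm a) y
          rw [commMul_apply, LinearMap.zero_apply, sub_eq_zero] at h
          rw [Algebra.smul_def, Algebra.smul_def, RingHom.id_apply, h] }
    have hE' : IsDiffOpLE A (n + 1) E' := IsDiffOpLE.of_coe_eq (R := R) (S := A) (D := E) (D' := E') rfl hE
    have h1 : E' 1 = 0 := by
      change E 1 = 0
      rw [← map_one (algebraMap A B)]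
      exact h0 1
    have hzero := (hE'.isDiffOpLE_zero_of_formallyUnramified).eq_zero_of_zero_of_map_one h1
    ext b
    exact LinearMap.congr_fun hzero b

/-- **Differential operators are determined on a formally unramified subalgebra**: for `B` formally unramified over `A`,
two `R`-linear differential operators of `B` of order `≤ n` which agree on `φ(A)` are equal.
[cite: EGAIV4, Prop. (16.8.8) p.42–43, Prop. (17.2.1)] -/
theorem IsDiffOpLE.eq_of_apply_algebraMap_eq [Algebra.FormallyUnramified A B] {n : ℕ} {D₁ D₂ : B →ₗ[R] B}
    (h₁ : IsDiffOpLE R n D₁) (h₂ : IsDiffOpLE R n D₂) (h : ∀ a : A, D₁ (algebraMap A B a) = D₂ (algebraMap A B a)) :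
    D₁ = D₂ :=
  sub_eq_zero.mp <| (h₁.sub h₂).eq_zero_of_apply_algebraMap R fun a => by rw [LinearMap.sub_apply, h a, sub_self]

end Unramified

/-! ## Formally étale algebras: unique extension -/

section Etale

variable (R : Type u) {A : Type v} {B : Type w} [CommRing R] [CommRing A] [CommRing B] [Algebra R A] [Algebra R B]
  [Algebra A B] [IsScalarTower R A B] [Algebra.FormallyEtale A B]

/-- **Along a formally étale algebra, a differential operator `T : A → B` of order `≤ n` over the structure map is the
restriction of a UNIQUE differential operator of `B` of order `≤ n`** (existence: `IsDiffOpOver.exists_extend`, formal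
smoothness; uniqueness: `IsDiffOpLE.eq_of_apply_algebraMap_eq`, formal unramifiedness).
[cite: EGAIV4, Déf. (17.1.1), Prop. (17.2.1), Cor. (17.2.4), Prop. (16.8.8)] -/
theorem IsDiffOpOver.existsUnique_extend {n : ℕ} {T : A →ₗ[R] B} (hT : IsDiffOpOver R n T) :
    ∃! D' : B →ₗ[R] B, IsDiffOpLE R n D' ∧ ∀ a : A, D' (algebraMap A B a) = T a := by
  obtain ⟨D', hD', hext⟩ := hT.exists_extend R
  refine ⟨D', ⟨hD', hext⟩, fun D'' ⟨hD'', hext''⟩ => ?_⟩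
  exact IsDiffOpLE.eq_of_apply_algebraMap_eq R hD'' hD' fun a => by rw [hext'' a, hext a]

/-- **Unique extension of differential operators along formally étale algebras** (the case `T = φ ∘ D`): every
differential operator `D : A → A` of order `≤ n` over `R` is the restriction of exactly one differential operator of `B` of
order `≤ n`. [cite: EGAIV4, Déf. (17.1.1), Prop. (17.2.1), Cor. (17.2.4), Prop. (16.8.8)] -/
theorem IsDiffOpLE.existsUnique_extend_of_formallyEtale {n : ℕ} {D : A →ₗ[R] A} (hD : IsDiffOpLE R n D) :
    ∃! D' : B →ₗ[R] B, IsDiffOpLE R n D' ∧ ∀ a : A, D' (algebraMap A B a) = algebraMap A B (D a) := by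
  have h := (hD.isDiffOpOver_comp (B := B)).existsUnique_extend R
  exact h

end Etale

end Literature.AlgebraicGeometry.Resolution
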